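import Mathlib
import Summits.AtomisticToContinuum.HydrodynamicLimit.Theorems.ImplosionDichotomyDenseExcursionSonicCavityDefs

/-!
# The weighted energy identity behind `stub_realBound` (crux `DenseExcursion`, line `sonic-cavity-renewal`)

Helper file (`--supports stmt-AtomisticToContinuum-12586`) for the registered stub `stub_realBound`
(`IsMonatomicProfile → OrigProfileEqs → CavityTube → RealBound`) of the line `sonic-cavity-renewal`
(vocabulary in `…SonicCavityDefs`, modes in `…R2Modes`).

**Mathematics.** Write a smooth radial mode as `v = (ŵ, ŝ)`, `Λ v = A v′ + B v` with
`A = [[W−1, 3S],[S/3, W−1]]`. With the symmetriser `H = diag(1, 9)` the matrix `HA = [[W−1, 3S],[3S, 9(W−1)]]` is real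
symmetric, and for the REAL energy `E = v*HAv = (W−1)|ŵ|² + 6S·Re(ŵ conj ŝ) + 9(W−1)|ŝ|²` and the weight `e^{5x}` one has
the pointwise identity (pure algebra along the mode equations, `realBound_energy_alg`)

  `(e^{5x} E)′ = e^{5x} (2 Re Λ · N − Q₂)`,  `N = |ŵ|² + 9|ŝ|²`,
  `Q₂ = (W′ − W + 5 − 2r)|ŵ|² + 18 (S + S′) Re(ŵ conj ŝ) + (−3W′ − 9W + 45 − 18r)|ŝ|²`;

the exponent `5` is exactly the one for which the cross coefficient is a multiple of `S + S′` (bounded at the centre,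
while `S ~ e^{−x}` is not). The `CavityTube` envelope (`|W| ≤ 1/4`, `|W′| ≤ 1/2`, angular repulsivity
`|S + S′| ≤ 3/8 − W`) and `r > 1` give `Q₂ ≤ 6N` on `x ≤ 1` (`realBound_Q_le`); at `x = 1` the sonic clause `W + S < 1`
with `S > 0` makes `HA` negative semidefinite, `E(1) ≤ 0` (`realBound_form_nonpos`); and `|e^{5x}E| ≤ 15 e^{4x}(|ŵ|²+|ŝ|²)`
on `x ≤ 0` from `eˣ S ≤ 1`. These four facts are packaged, with the energy hidden behind an existential, as
`realBound_energy` — the only statement the stub file consumes.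
NOT here: the centre decay of a regular pair, the Grönwall uniqueness on `x ≥ 1/2`, the stub itself
(`…SonicRealBoundUnique`, `…SonicRealBound`).
-/

noncomputable section

open Filter Set
open scoped Topology ContDiff

namespace Summit.AtomisticToContinuum.HydrodynamicLimit.Theorems.SonicCavityRenewal

open Summit.AtomisticToContinuum.HydrodynamicLimit.Theorems.R2OneModeTwoConditions

/-! ## Calculus of real and imaginary parts -/

/-- The real part of a differentiable curve `f : ℝ → ℂ` has derivative `Re f′`. -/
theorem hasDerivAt_re_comp {f : ℝ → ℂ} {f' : ℂ} {x : ℝ} (h : HasDerivAt f f' x) :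
    HasDerivAt (fun y => (f y).re) f'.re x := by
  simpa [Function.comp_def] using Complex.reCLM.hasFDerivAt.comp_hasDerivAt x h

/-- The imaginary part of a differentiable curve `f : ℝ → ℂ` has derivative `Im f′`. -/
theorem hasDerivAt_im_comp {f : ℝ → ℂ} {f' : ℂ} {x : ℝ} (h : HasDerivAt f f' x) :
    HasDerivAt (fun y => (f y).im) f'.im x := by
  simpa [Function.comp_def] using Complex.imCLM.hasFDerivAt.comp_hasDerivAt x h

/-! ## The algebraic identity -/

/-- PURE ALGEBRA: the weighted energy identity with symmetriser `diag(1, 9)` and weight derivative `w′ = 5w`.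
If the real 4-vector `(a₁, a₂, b₁, b₂)` (real and imaginary parts of `(ŵ, ŝ)`) satisfies the four real mode
equations with rate `Λ = Lr + i Li`, then the raw derivative of `((W−1)|a|² + 6S a·b + 9(W−1)|b|²)·w` equals
`(2 Lr (|a|² + 9|b|²) − Q₂)·w`. -/
theorem realBound_energy_alg (W W' S S' a₁ a₂ b₁ b₂ a₁' a₂' b₁' b₂' Lr Li r w : ℝ)
    (h1 : (W - 1) * a₁' + 3 * S * b₁' + (W' + 2 * W - r) * a₁ + (3 * S' + 6 * S) * b₁ = Lr * a₁ - Li * a₂)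
    (h2 : (W - 1) * a₂' + 3 * S * b₂' + (W' + 2 * W - r) * a₂ + (3 * S' + 6 * S) * b₂ = Lr * a₂ + Li * a₁)
    (h3 : S / 3 * a₁' + (W - 1) * b₁' + (S' + 2 * S) * a₁ + (W' / 3 + 2 * W - r) * b₁ = Lr * b₁ - Li * b₂)
    (h4 : S / 3 * a₂' + (W - 1) * b₂' + (S' + 2 * S) * a₂ + (W' / 3 + 2 * W - r) * b₂ = Lr * b₂ + Li * b₁) :
    5 * w * ((W - 1) * (a₁ * a₁ + a₂ * a₂) + 6 * S * (a₁ * b₁ + a₂ * b₂) + 9 * (W - 1) * (b₁ * b₁ + b₂ * b₂))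
      + w * (W' * (a₁ * a₁ + a₂ * a₂) + (W - 1) * (a₁' * a₁ + a₁ * a₁' + (a₂' * a₂ + a₂ * a₂'))
        + (6 * S' * (a₁ * b₁ + a₂ * b₂) + 6 * S * (a₁' * b₁ + a₁ * b₁' + (a₂' * b₂ + a₂ * b₂')))
        + (9 * W' * (b₁ * b₁ + b₂ * b₂) + 9 * (W - 1) * (b₁' * b₁ + b₁ * b₁' + (b₂' * b₂ + b₂ * b₂'))))
    = w * (2 * Lr * (a₁ * a₁ + a₂ * a₂ + 9 * (b₁ * b₁ + b₂ * b₂))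
        - ((W' - W + 5 - 2 * r) * (a₁ * a₁ + a₂ * a₂) + 18 * (S + S') * (a₁ * b₁ + a₂ * b₂)
          + (-3 * W' - 9 * W + 45 - 18 * r) * (b₁ * b₁ + b₂ * b₂))) := by
  linear_combination (2 * a₁ * w) * h1 + (2 * a₂ * w) * h2 + (18 * b₁ * w) * h3 + (18 * b₂ * w) * h4

/-- The four REAL mode equations: real and imaginary parts of `Λ ŵ = linW`, `Λ ŝ = linS` (the operator has real
coefficients). -/
theorem modeEqs_real {r : ℝ} {W S : ℝ → ℝ} {Λ : ℂ} {ŵ ŝ : ℝ → ℂ} {x : ℝ}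
    (h₁ : Λ * ŵ x = linW r W S ŵ ŝ x) (h₂ : Λ * ŝ x = linS r W S ŵ ŝ x) :
    ((W x - 1) * (deriv ŵ x).re + 3 * S x * (deriv ŝ x).re + (deriv W x + 2 * W x - r) * (ŵ x).re
        + (3 * deriv S x + 6 * S x) * (ŝ x).re = Λ.re * (ŵ x).re - Λ.im * (ŵ x).im) ∧
    ((W x - 1) * (deriv ŵ x).im + 3 * S x * (deriv ŝ x).im + (deriv W x + 2 * W x - r) * (ŵ x).im
        + (3 * deriv S x + 6 * S x) * (ŝ x).im = Λ.re * (ŵ x).im + Λ.im * (ŵ x).re) ∧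
    (S x / 3 * (deriv ŵ x).re + (W x - 1) * (deriv ŝ x).re + (deriv S x + 2 * S x) * (ŵ x).re
        + (deriv W x / 3 + 2 * W x - r) * (ŝ x).re = Λ.re * (ŝ x).re - Λ.im * (ŝ x).im) ∧
    (S x / 3 * (deriv ŵ x).im + (W x - 1) * (deriv ŝ x).im + (deriv S x + 2 * S x) * (ŵ x).im
        + (deriv W x / 3 + 2 * W x - r) * (ŝ x).im = Λ.re * (ŝ x).im + Λ.im * (ŝ x).re) := by
  have e1 := congrArg Complex.re h₁
  have e2 := congrArg Complex.im h₁
  have e3 := congrArg Complex.re h₂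
  have e4 := congrArg Complex.im h₂
  simp only [linW, linS, Complex.add_re, Complex.add_im, Complex.mul_re, Complex.mul_im,
    Complex.ofReal_re, Complex.ofReal_im, zero_mul, sub_zero, add_zero] at e1 e2 e3 e4
  exact ⟨by linarith, by linarith, by linarith, by linarith⟩

/-! ## The pointwise energy identity of a mode -/

/-- THE WEIGHTED ENERGY IDENTITY. For differentiable `W, S, ŵ, ŝ` satisfying the mode equations everywhere, the
weighted energy `F(y) = e^{5y}((W−1)|ŵ|² + 6S Re(ŵ conj ŝ) + 9(W−1)|ŝ|²)` (written in real and imaginary parts)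
has derivative `e^{5x}(2 Re Λ (|ŵ|² + 9|ŝ|²) − Q₂)` with
`Q₂ = (W′ − W + 5 − 2r)|ŵ|² + 18(S + S′)Re(ŵ conj ŝ) + (−3W′ − 9W + 45 − 18r)|ŝ|²`. -/
theorem realBound_energy_hasDerivAt {r : ℝ} {W S : ℝ → ℝ} {Λ : ℂ} {ŵ ŝ : ℝ → ℂ}
    (hW : Differentiable ℝ W) (hS : Differentiable ℝ S) (hŵ : Differentiable ℝ ŵ)
    (hŝ : Differentiable ℝ ŝ)
    (hmode : ∀ x, Λ * ŵ x = linW r W S ŵ ŝ x ∧ Λ * ŝ x = linS r W S ŵ ŝ x) (x : ℝ) :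
    HasDerivAt (fun y => Real.exp (5 * y) * ((W y - 1) * ((ŵ y).re * (ŵ y).re + (ŵ y).im * (ŵ y).im)
        + 6 * S y * ((ŵ y).re * (ŝ y).re + (ŵ y).im * (ŝ y).im)
        + 9 * (W y - 1) * ((ŝ y).re * (ŝ y).re + (ŝ y).im * (ŝ y).im)))
      (Real.exp (5 * x) * (2 * Λ.re * ((ŵ x).re * (ŵ x).re + (ŵ x).im * (ŵ x).im
          + 9 * ((ŝ x).re * (ŝ x).re + (ŝ x).im * (ŝ x).im))
        - ((deriv W x - W x + 5 - 2 * r) * ((ŵ x).re * (ŵ x).re + (ŵ x).im * (ŵ x).im)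
          + 18 * (S x + deriv S x) * ((ŵ x).re * (ŝ x).re + (ŵ x).im * (ŝ x).im)
          + (-3 * deriv W x - 9 * W x + 45 - 18 * r) * ((ŝ x).re * (ŝ x).re + (ŝ x).im * (ŝ x).im))))
      x := by
  obtain ⟨h1, h2, h3, h4⟩ := modeEqs_real (hmode x).1 (hmode x).2
  have ha₁ := hasDerivAt_re_comp (hŵ x).hasDerivAt
  have ha₂ := hasDerivAt_im_comp (hŵ x).hasDerivAt
  have hb₁ := hasDerivAt_re_comp (hŝ x).hasDerivAt
  have hb₂ := hasDerivAt_im_comp (hŝ x).hasDerivAt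
  have hW1 : HasDerivAt (fun y => W y - 1) (deriv W x) x := (hW x).hasDerivAt.sub_const 1
  have hS6 : HasDerivAt (fun y => 6 * S y) (6 * deriv S x) x := (hS x).hasDerivAt.const_mul 6
  have hW9 : HasDerivAt (fun y => 9 * (W y - 1)) (9 * deriv W x) x := hW1.const_mul 9
  have hexp : HasDerivAt (fun y => Real.exp (5 * y)) (5 * Real.exp (5 * x)) x := by
    have h := ((hasDerivAt_id' x).const_mul 5).exp
    simpa [mul_comm] using h
  have hraw := hexp.fun_mul (((hW1.fun_mul ((ha₁.fun_mul ha₁).fun_add (ha₂.fun_mul ha₂))).fun_add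
    (hS6.fun_mul ((ha₁.fun_mul hb₁).fun_add (ha₂.fun_mul hb₂)))).fun_add
      (hW9.fun_mul ((hb₁.fun_mul hb₁).fun_add (hb₂.fun_mul hb₂))))
  refine hraw.congr_deriv ?_
  rw [realBound_energy_alg (W x) (deriv W x) (S x) (deriv S x) (ŵ x).re (ŵ x).im (ŝ x).re (ŝ x).im
    (deriv ŵ x).re (deriv ŵ x).im (deriv ŝ x).re (deriv ŝ x).im Λ.re Λ.im r (Real.exp (5 * x)) h1 h2 h3 h4]

/-! ## Pointwise bounds -/

/-- The quadratic form `Q₂` is at most `6(|ŵ|² + 9|ŝ|²)` under the `CavityTube` envelope `|W| ≤ 1/4`, `|W′| ≤ 1/2`,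
`|S + S′| ≤ 5/8` and `r > 1` (crude: `15/4 + 15/8 ≤ 6` and `123/4 + 135/8 ≤ 54`). -/
theorem realBound_Q_le (W W' σ r a₁ a₂ b₁ b₂ : ℝ) (hW : |W| ≤ 1 / 4) (hW' : |W'| ≤ 1 / 2) (hσ : |σ| ≤ 5 / 8)
    (hr : 1 < r) :
    (W' - W + 5 - 2 * r) * (a₁ * a₁ + a₂ * a₂) + 18 * σ * (a₁ * b₁ + a₂ * b₂)
        + (-3 * W' - 9 * W + 45 - 18 * r) * (b₁ * b₁ + b₂ * b₂)
      ≤ 6 * (a₁ * a₁ + a₂ * a₂ + 9 * (b₁ * b₁ + b₂ * b₂)) := by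
  obtain ⟨hW₁, hW₂⟩ := abs_le.mp hW
  obtain ⟨hW₁', hW₂'⟩ := abs_le.mp hW'
  have hA : 0 ≤ a₁ * a₁ + a₂ * a₂ := add_nonneg (mul_self_nonneg _) (mul_self_nonneg _)
  have hB : 0 ≤ b₁ * b₁ + b₂ * b₂ := add_nonneg (mul_self_nonneg _) (mul_self_nonneg _)
  have hP : |a₁ * b₁ + a₂ * b₂| ≤ (a₁ * a₁ + a₂ * a₂ + 9 * (b₁ * b₁ + b₂ * b₂)) / 6 :=
    abs_le.mpr ⟨by nlinarith [sq_nonneg (a₁ + 3 * b₁), sq_nonneg (a₂ + 3 * b₂)],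
      by nlinarith [sq_nonneg (a₁ - 3 * b₁), sq_nonneg (a₂ - 3 * b₂)]⟩
  have h1 : (W' - W + 5 - 2 * r) * (a₁ * a₁ + a₂ * a₂) ≤ 15 / 4 * (a₁ * a₁ + a₂ * a₂) :=
    mul_le_mul_of_nonneg_right (by linarith) hA
  have h3 : (-3 * W' - 9 * W + 45 - 18 * r) * (b₁ * b₁ + b₂ * b₂) ≤ 123 / 4 * (b₁ * b₁ + b₂ * b₂) :=
    mul_le_mul_of_nonneg_right (by linarith) hB
  have h2 : σ * (a₁ * b₁ + a₂ * b₂) ≤ 5 / 8 * ((a₁ * a₁ + a₂ * a₂ + 9 * (b₁ * b₁ + b₂ * b₂)) / 6) :=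
    calc σ * (a₁ * b₁ + a₂ * b₂) ≤ |σ * (a₁ * b₁ + a₂ * b₂)| := le_abs_self _
      _ = |σ| * |a₁ * b₁ + a₂ * b₂| := abs_mul _ _
      _ ≤ 5 / 8 * ((a₁ * a₁ + a₂ * a₂ + 9 * (b₁ * b₁ + b₂ * b₂)) / 6) :=
        mul_le_mul hσ hP (abs_nonneg _) (by norm_num)
  linarith

/-- At a point where `W + S < 1` and `S > 0` the symmetrised principal part `HA = [[W−1, 3S],[3S, 9(W−1)]]` is
negative semidefinite: `(W−1)|a|² + 6S a·b + 9(W−1)|b|² ≤ 0` (complete the square after multiplying by `1 − W > 0`). -/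
theorem realBound_form_nonpos (W S a₁ a₂ b₁ b₂ : ℝ) (hWS : W + S < 1) (hS : 0 < S) :
    (W - 1) * (a₁ * a₁ + a₂ * a₂) + 6 * S * (a₁ * b₁ + a₂ * b₂) + 9 * (W - 1) * (b₁ * b₁ + b₂ * b₂) ≤ 0 := by
  have hu : 0 < 1 - W := by linarith
  have hB : 0 ≤ b₁ * b₁ + b₂ * b₂ := add_nonneg (mul_self_nonneg _) (mul_self_nonneg _)
  have huS : 0 ≤ (1 - W) ^ 2 - S ^ 2 := by nlinarith
  have key : (1 - W) * -((W - 1) * (a₁ * a₁ + a₂ * a₂) + 6 * S * (a₁ * b₁ + a₂ * b₂)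
      + 9 * (W - 1) * (b₁ * b₁ + b₂ * b₂)) =
      ((1 - W) * a₁ - 3 * S * b₁) ^ 2 + ((1 - W) * a₂ - 3 * S * b₂) ^ 2
        + 9 * ((1 - W) ^ 2 - S ^ 2) * (b₁ * b₁ + b₂ * b₂) := by ring
  have h0 : 0 ≤ (1 - W) * -((W - 1) * (a₁ * a₁ + a₂ * a₂) + 6 * S * (a₁ * b₁ + a₂ * b₂)
      + 9 * (W - 1) * (b₁ * b₁ + b₂ * b₂)) := by
    rw [key]
    exact add_nonneg (add_nonneg (sq_nonneg _) (sq_nonneg _)) (mul_nonneg (by linarith) hB)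
  have := (mul_nonneg_iff_of_pos_left hu).mp h0
  linarith

/-- On `x ≤ 0` the weighted energy is small: `|e^{5x} E| ≤ 15 e^{4x} (|ŵ|² + |ŝ|²)` when `|W| ≤ 1/4` and
`0 < S ≤ e^{−x}` (real-variable form: `m = e^{−x} ≥ 1`, `w = e^{5x}`, `w·m = e^{4x}`). -/
theorem realBound_energy_abs_le (W s m w A B P : ℝ) (hW : |W| ≤ 1 / 4) (hs : 0 < s) (hsm : s ≤ m) (hm : 1 ≤ m)
    (hw : 0 ≤ w) (hA : 0 ≤ A) (hB : 0 ≤ B) (hP : |P| ≤ (A + B) / 2) :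
    |w * ((W - 1) * A + 6 * s * P + 9 * (W - 1) * B)| ≤ 15 * (w * m) * (A + B) := by
  have hW1 : |W - 1| ≤ 5 / 4 := by
    obtain ⟨h₁, h₂⟩ := abs_le.mp hW
    exact abs_le.mpr ⟨by linarith, by linarith⟩
  have e1 : |(W - 1) * A| ≤ 5 / 4 * A := by
    rw [abs_mul, abs_of_nonneg hA]; exact mul_le_mul_of_nonneg_right hW1 hA
  have e2 : |6 * s * P| ≤ 6 * s * ((A + B) / 2) := by
    rw [abs_mul, abs_of_nonneg (by positivity : (0 : ℝ) ≤ 6 * s)]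
    exact mul_le_mul_of_nonneg_left hP (by positivity)
  have e3 : |9 * (W - 1) * B| ≤ 9 * (5 / 4) * B := by
    rw [abs_mul, abs_mul, abs_of_nonneg hB, abs_of_nonneg (by norm_num : (0 : ℝ) ≤ 9)]
    exact mul_le_mul_of_nonneg_right (mul_le_mul_of_nonneg_left hW1 (by norm_num)) hB
  have hE : |(W - 1) * A + 6 * s * P + 9 * (W - 1) * B| ≤ 15 * m * (A + B) := by
    refine (abs_add_three _ _ _).trans ?_
    have k1 : s * (A + B) ≤ m * (A + B) := mul_le_mul_of_nonneg_right hsm (add_nonneg hA hB)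
    have k2 : 0 ≤ (m - 1) * A := mul_nonneg (by linarith) hA
    have k3 : 0 ≤ (m - 1) * B := mul_nonneg (by linarith) hB
    nlinarith
  rw [abs_mul, abs_of_nonneg hw]
  calc w * |(W - 1) * A + 6 * s * P + 9 * (W - 1) * B| ≤ w * (15 * m * (A + B)) :=
        mul_le_mul_of_nonneg_left hE hw
    _ = 15 * (w * m) * (A + B) := by ring

/-! ## The packaged energy function -/

/-- **Helper `realBound_energy` of `stub_realBound`: THE WEIGHTED ENERGY OF A SMOOTH RADIAL MODE.** For a monatomic profile
in the cavity tube and a smooth radial mode `(Λ, ŵ, ŝ)` there is a differentiable real function `f` (namely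
`e^{5x}((W−1)|ŵ|² + 6S Re(ŵ conj ŝ) + 9(W−1)|ŝ|²)`) with: (i) derivative `f′` everywhere; (ii) on `x ≤ 1`,
`f′ ≥ 2(Re Λ − 3)(|ŵ|² + 9|ŝ|²)e^{5x}` (energy identity + tube envelope); (iii) `f 1 ≤ 0` (subsonic exterior
`W + S < 1` at `x = 1`); (iv) on `x ≤ 0`, `|f| ≤ 15 e^{4x}(|ŵ|² + |ŝ|²)` (from `eˣS ≤ 1`). -/
theorem realBound_energy : ∀ (r : ℝ) (W S : ℝ → ℝ) (Λ : ℂ) (ŵ ŝ : ℝ → ℂ), IsMonatomicProfile r W S →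
    CavityTube r W S → IsSmoothRadialMode r W S Λ ŵ ŝ → ∃ f f' : ℝ → ℝ, (∀ x, HasDerivAt f (f' x) x) ∧
      (∀ x, x ≤ 1 → 2 * (Λ.re - 3) * (‖ŵ x‖ ^ 2 + 9 * ‖ŝ x‖ ^ 2) * Real.exp (5 * x) ≤ f' x) ∧ f 1 ≤ 0 ∧
      (∀ x, x ≤ 0 → |f x| ≤ 15 * Real.exp (4 * x) * (‖ŵ x‖ ^ 2 + ‖ŝ x‖ ^ 2)) := by
  intro r W S Λ ŵ ŝ hP hT hm
  obtain ⟨hr, -, hW, hS, hSpos, -⟩ := hP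
  obtain ⟨-, -, hsub, -, -, -, hang, hWenv, hSenv, -⟩ := hT
  obtain ⟨⟨hŵ, hŝ, -⟩, -, hmode⟩ := hm
  have hW1 : Differentiable ℝ W := hW.differentiable (by simp)
  have hS1 : Differentiable ℝ S := hS.differentiable (by simp)
  have hŵ1 : Differentiable ℝ ŵ := hŵ.differentiable (by simp)
  have hŝ1 : Differentiable ℝ ŝ := hŝ.differentiable (by simp)
  have hnorm : ∀ z : ℂ, ‖z‖ ^ 2 = z.re * z.re + z.im * z.im := fun z => by
    rw [Complex.sq_norm, Complex.normSq_apply]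
  refine ⟨_, _, realBound_energy_hasDerivAt hW1 hS1 hŵ1 hŝ1 hmode, ?_, ?_, ?_⟩
  · -- (ii) the lower bound on `f′` from `Q₂ ≤ 6N`
    intro x hx
    obtain ⟨hWx, hW'x, -⟩ := hWenv x hx
    have hσ : |S x + deriv S x| ≤ 5 / 8 := by
      have h := hang x hx
      obtain ⟨h₁, h₂⟩ := abs_le.mp hWx
      exact abs_le.mpr ⟨by linarith [neg_abs_le (S x + deriv S x)], by linarith [le_abs_self (S x + deriv S x)]⟩
    have hQ := realBound_Q_le (W x) (deriv W x) (S x + deriv S x) r (ŵ x).re (ŵ x).im (ŝ x).re (ŝ x).im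
      hWx hW'x hσ hr
    rw [hnorm, hnorm]
    have hw : 0 < Real.exp (5 * x) := Real.exp_pos _
    nlinarith
  · -- (iii) the boundary sign at `x = 1`
    have h1 : W 1 + S 1 < 1 := hsub 1 one_pos
    have := realBound_form_nonpos (W 1) (S 1) (ŵ 1).re (ŵ 1).im (ŝ 1).re (ŝ 1).im h1 (hSpos 1)
    have hw : 0 < Real.exp (5 * (1 : ℝ)) := Real.exp_pos _
    nlinarith
  · -- (iv) smallness at the centre
    intro x hx
    obtain ⟨hWx, -, -⟩ := hWenv x (by linarith)
    obtain ⟨-, hS1x, -, -⟩ := hSenv x (by linarith)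
    have hm : 1 ≤ Real.exp (-x) := Real.one_le_exp (by linarith)
    have hsm : S x ≤ Real.exp (-x) := by
      have h := mul_le_mul_of_nonneg_left hS1x (Real.exp_pos (-x)).le
      rwa [← mul_assoc, ← Real.exp_add, show -x + x = 0 by ring, Real.exp_zero, one_mul, mul_one] at h
    have hP : |(ŵ x).re * (ŝ x).re + (ŵ x).im * (ŝ x).im| ≤
        (((ŵ x).re * (ŵ x).re + (ŵ x).im * (ŵ x).im) + ((ŝ x).re * (ŝ x).re + (ŝ x).im * (ŝ x).im)) / 2 :=
      abs_le.mpr ⟨by nlinarith [sq_nonneg ((ŵ x).re + (ŝ x).re), sq_nonneg ((ŵ x).im + (ŝ x).im)],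
        by nlinarith [sq_nonneg ((ŵ x).re - (ŝ x).re), sq_nonneg ((ŵ x).im - (ŝ x).im)]⟩
    have h := realBound_energy_abs_le (W x) (S x) (Real.exp (-x)) (Real.exp (5 * x)) _ _ _ hWx (hSpos x) hsm hm
      (Real.exp_pos _).le (add_nonneg (mul_self_nonneg _) (mul_self_nonneg _))
      (add_nonneg (mul_self_nonneg _) (mul_self_nonneg _)) hP
    rw [← Real.exp_add, show 5 * x + -x = 4 * x by ring] at h
    rw [hnorm, hnorm]
    exact h

end Summit.AtomisticToContinuum.HydrodynamicLimit.Theorems.SonicCavityRenewal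

end
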